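import Mathlib
import Literature.MathematicalPhysics.QuantumFieldTheory.Balaban1983to89.B11
import Literature.MathematicalPhysics.QuantumFieldTheory.Balaban1983to89.B11B3
import Literature.MathematicalPhysics.QuantumFieldTheory.Balaban1983to89.B11Smallness

/-!
# `Balaban1983to89.B11Eq161HBChain` — T. Bałaban, *The variational problem and background fields in renormalization group method
# for lattice gauge theories*, Commun. Math. Phys. **102** (1985) 277–309 [Balaban1985Variational], Sect. F pp. 303–305: the printed
# numeric chain **(161)** (five members) and its continuation (163) ⇒ (164) ⇒ (165) ⇒ (167) ⇒ (168) / (169), KERNEL-CHECKED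

statement-level skeleton of published theorems with citation tags; proofs where landed; nothing here is a claim about the Yang–Mills mass gap

PDF held: `paper:balaban1985-cmp102-variational-background` (journal page = PDF page + 276); pp. 300–305 [PDF 24–29] read by this seat from
`lit read` text and, for the displays (159)–(169), from the page renders
`run/shared/lean/pub/pub-balaban/b2b-balaban-ref1/pages/1985-cmp102-variational-background/…-p027-x2.png, …-p028-x2.png` (images).

CITATION HEADER (lean-in-tree rule 2026-08-18).  WHAT IS REPRODUCED: SKELETON rows (reader r08 `ROWS-B11.md`) **B11.Eq159** member (161),
**B11.Eq163** ((163)–(164)), **B11.Eq165** ((165)–(167)), **B11.Eq168** ((168)), **B11.Eq169** ((169)).  References of the paper used: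
[3] = [Balaban1984PropagatorsII] ((2.46)–(2.48) multiscale distance, Lemma 2.1; sibling modules `…B6`, `…B6RandomWalk`, and the B₃-module
`…B11B3` whose `term162`/`sum162` ARE the inner sum of (162)), [6] = [Balaban1985RegularSpaces] ((1.54) p. 85 / (1.142) p. 100, Lemma 1).
The sibling `…B11B3` (unit b2b-balaban-pv21) records in its header, verbatim: *"(iv) the chain (161) itself and (163)–(164) (`…B11`, cell row
C-B11-F1) — untouched"*; `ROWS-B11.md` row B11.Eq159: *"(160) and the first line of (161) … typed by reference"*.  This module proves the chain.

THE PRINT (p. 303 [PDF 27], verbatim).  *"This bound [(160)] and the global bound (152) imply the following bounds on the cube Δ(y₁),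
Δ(y₁) = Δ₀ or y₁ ∈ □,
 |HB|, |∇^ηHB|, |∂^{η*}∂^ηHB|, |Δ^ηHB| ≦ B₀ Σ_{c∈ℭ_k} e^{−δ₀d(y₁,c₋)}(L^{j(c)}η)^{−1}|B(c)|
 < dB₀ Σ_{y₂∈(Λ′_{k−1}∪Λ′_k)∩□_k} e^{−δ₀d(y₁,y₂)}(2d² + |y₂ − y|)4L²ε₁ + dB₀ Σ_{y₂∈ℭ_k∖□_k} e^{−(1/2)δ₀d(y₁,y₂)}e^{−(1/2)δ₀R₁M₁}(L^{j₂}η)^{−1}18d²L³Mε₀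
 ≦ dB₀ Σ_{y₂∈(Λ′_{k−1}∪Λ′_k)∩□_k} e^{−(1/2)δ₀d(y₁,y₂)}(d(y₁,y₂) + 3d²M_Δ)4L²ε₁
   + dB₀ Σ_{y₂∈ℭ_k∖□_k} e^{−(1/2)δ₀d(y₁,y₂)}(d(y₁,y₂) + M_Δ)(L^{j₂}η)^{−1}e^{−(1/2)δ₀R₁M₁}18d²L³ε₀
 ≦ 18d³L³B₀ Σ_{y₂∈ℭ_k} e^{−(1/2)δ₀d(y₁,y₂)}(d(y₁,y₂) + 1)(L^{j₂}η)^{−1} · M_Δ max{ε₁, e^{−(1/2)δ₀R₁M₁}ε₀},  (161)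
where y₁ ∈ Δ, and M_Δ = 1 for Δ = Δ₀, M_Δ = M for Δ = □."*  Inputs named by the print: (160) p. 303 *"|B(x,x′)| < (8d²L² + 4L²|x − y|)ε₁
for ⟨x,x′⟩ ∈ □′_k^{(k−1)} ∪ □″_k^{(k)}"*; (155) p. 302 *"V₁ = e^{iB} with |B| < 18d²L³Mε₀"*; (144) p. 300 *"dist(□_{n+1}, □_n^c) = R₁M₁L^nη,
n = 0, 1, …, j"* with *"For simplicity of notations we assume that j = k"* (so L^kη = 1, (5) p. 278 *"η = L^{−k}"*) and p. 300 *"To prove that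
U_k is in the space (8) we will take M = R₁M₁"*, p. 304 *"where □ is a cube of the size R₁M₁ containing Δ₀"*.  Then pp. 304–305 [PDF 28–29]:
(163) *"B₃e^{−(1/2)δ₀R₁M₁} ≦ ½"*, (164) *"|HB|, … < ¼M_Δmax{B₃ε₁, ½ε₀}"*, (165)–(167), (168) *"|D^{η*}_{U₁}∂U₁| < ε′ + 86dε′² < 2ε′ on Δ₀"*,
(169) *"(the left-hand side of (167)) < ¼MB₃ε₁ + ⅛M′B₃ε₁ < ½MB₃ε₁"* — quoted in full at the theorems.

WHAT IS CERTIFIED (kernel, sorry-free; axioms `propext` / `Classical.choice` / `Quot.sound`).  Over the tree carrier `B6.Geometry` of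
[3] (`g.Site` ⊇ ℭ_k as a `Finset`, `g.dist` = d(·,·), `g.len y₂` = L^{j₂}η), a cell c of ℭ_k being written (c₋, μ) = (y₂, μ), μ ∈ `Fin d`:
§1 `kernelSum` (member 1's right side), `line2`, `line3` (members 2–3 in the located form below), `line4` (member 5 = 18d³L³B₀·`B11B3.sum162`·
   M_Δmax{…} VERBATIM).
§2 **`kernelSum_le_line2`** (member 1 ≦ member 2: near/far split of ℭ_k, (160) on the near sites, (155) + the (144)-separation
   d(y₁,y₂) ≥ R₁M₁ on the far sites — e^{−δ₀d} ≤ e^{−½δ₀d}e^{−½δ₀R₁M₁} —, d cells per site), **`kernelSum_lt_line2`** (the printed STRICT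
   sign from the strict (160), (155), ℭ_k ≠ ∅), **`line2_le_line3`** (e^{−δ₀d} ≤ e^{−½δ₀d}; 2d² + |y₂ − y| ≤ d(y₁,y₂) + 3d²M_Δ from the
   located triangle inequality |y₂ − y| ≤ d(y₁,y₂) + ρ₁, ρ₁ ≤ d²M_Δ; M ≤ d(y₁,y₂) + M_Δ from the PRINTED TWO CASES (M = R₁M₁ ∧ M_Δ = 1)
   ∨ M_Δ = M), **`line3_le_line4`** (termwise domination by the summand of (161)₅: 12d³L² ≤ 18d³L³, t + 3d²M_Δ ≤ 3d²M_Δ(t + 1), t + M_Δ ≤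
   M_Δ(t + 1), ε₁ ∨ e^{−½δ₀R₁M₁}ε₀ ≤ max), **`ineq161`** (END TO END, member 1 ≦ member 5, as printed).
§3 **`line4_le_quarter`** ((162) + (163) ⇒ member 5 ≦ ¼M_Δmax{B₃ε₁, ½ε₀}; 72 = 4·18 via `B11B3.ineq161_le_quarter_B3`), **`ineq164`** /
   **`ineq164_strict`** ((164) for every quantity majorised by member 1).
§4 **`ineq165`** ((159) + (158) + ‖G̃‖, ‖H‖ ≤ B₀ + Prop. 4 (98) + (55) + (164) ⇒ (165) line 1, over a seminormed group with the "on Δ" seminorm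
   p ≤ ‖·‖), **`ineq167`** ((165) line 2 by `B11Smallness.ineq165_quadratic_terms` + (166) ⇒ (167) by `B11Smallness.ineq167_of_166`).
§5 first case: **`lt_eps'_of_167`**, **`ineq168`**, **`ineq168_radius`** ((1.142)|_{α₀=0} shape + ε′ ≤ 1 + 86dε′ < 1 ⇒ (168) ⇒ radius
   max{B₃ε₁, ½ε₀} = 2ε′ — the one-step radius consumed by `B11Prop8Assembly.HalvingStep`).
§6 second case: **`ineq169_regularity`** ((167) at M_Δ = M, ε₀ = B₃ε₁, M′ ≤ M ⇒ (169) < ½MB₃ε₁ ≤ B₃Mε₁ = the radii of (9), (10) at the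
   normalisation L^kη = 1), via `B11.ineq169`.

TRANSCRIPT NOTE (located print imprecision, harmless; for the fold owner's T-list and the cell's errata candidates).  In members 2 and 3 of
(161) the near sums carry no factor (L^{j₂}η)^{−1}, although member 1 has (L^{j(c)}η)^{−1} for every cell and member 5 has (L^{j₂}η)^{−1} for
every y₂ ∈ ℭ_k; under η = L^{−k} this factor is 1 on Λ′_k but L > 1 on Λ′_{k−1}, so member 1 ≦ member 2 AS PRINTED would need |B(c)| ≤
L^{−1}(2d² + |y₂ − y|)4L²ε₁ on the (k−1)-cells, which (160) does not give.  `line2`/`line3` therefore KEEP the factor (L^{j₂}η)^{−1} in the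
near sums (the located form in which member 1 ≦ member 2 ≦ member 3 hold); member 3 ≦ member 5 then needs 12d³L²·(L^{j₂}η)^{−1} ≤
18d³L³·(L^{j₂}η)^{−1}, true, so the END-TO-END inequality (161)₁ ≦ (161)₅ holds exactly as printed (`ineq161`), and so do (163)–(169).

HONEST SCOPE — what is NOT proved here (hypotheses, each a displayed statement of the paper or a located elementary fact, never a new
named fact): member 1 itself (the kernel bound of H at the background 1 — (46) p. 285 / [3], [5]; `hQ`); (160) (row B11.Eq159, PROVED on the
lattice carrier in `B11Eq160BondField`, here the displayed inequality `h160`); (155) (row B11.Eq154, PROVED in `B11Eq155BlockLog`; `h155`);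
the geometry of ℭ_k ((148): the near/far partition `Cn ∪ Cf = ℭ`, the (144)-separation `h144`, the triangle inequality `hρ`/`hρ₁` with [3]
(2.48) "multiscale distance ≥ lattice distance", d(·,·) ≥ 0); in §4 the existence of the solution A₁ of (158) (row B11.Eq157,
`B11Prop6Scheme.eq158_solution`), Prop. 4 (98), (55), the norms of G̃ and H; in §5 the bound (1.54)/(1.142) of [6] at U₀ = 1 and the words
*"similarly for |∂U₁ − 1|"* (not displayed in print; not treated); the claim "B₃ depends on d and L only" ((162), `B11B3.claim162_of_lemma21`).
Mega-formalization `lit-balaban`, HOME `run/shared/lean/pub/lit-balaban/`, reader/typer seat r08 gen 8 (unit `lit-balaban-r08`, B11 fold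
owner).  Imports `B11`, `B11B3`, `B11Smallness`; modifies nothing there.  Net new unproved facts: 0 (four bookkeeping `def`s with bodies +
theorems).VERSIONS: v1 = p263534 (ACCEPTED 54b2f218a275); v1.1 (append-only, every v1 declaration byte-identical) adds §7 — the companion
«similarly for |∂U₁ − 1|» of (168): `e1_eq_eps'`, `plaq168_asPrinted_exceeds` (the located gap G-B11-02 with the printed ⅛ of (166)),
`ineq167_sixteenth`, `plaq168_repaired` (the repair (166′) K·a₅ ≦ 1/16, as used by `B11SectFAssembly.firstCase_arith`, p264246).
-/

namespace Literature.MathematicalPhysics.QuantumFieldTheory.Balaban1983to89.B11Eq161HBChain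

open Literature.MathematicalPhysics.QuantumFieldTheory.Balaban1983to89
open Finset B11B3

/-! ## §1 The five members of (161) p. 303 -/

/-- **(161), first member's right-hand side** (p. 303 [PDF 27], verbatim: *"|HB|, |∇^ηHB|, |∂^{η*}∂^ηHB|, |Δ^ηHB| ≦
B₀ Σ_{c∈ℭ_k} e^{−δ₀d(y₁,c₋)}(L^{j(c)}η)^{−1}|B(c)|"*): the kernel sum of the operator H at the background 1 (p. 302: *"all the
operators in this section are taken without any external gauge field configuration"*) over the cells c of ℭ_k ((148) p. 301),
a cell being written c = ⟨y₂, y₂ + L^{j₂}ηe_μ⟩ with lower end c₋ = y₂ ∈ ℭ_k ⊆ `g.Site` and direction μ ∈ `Fin d`;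
`absB y₂ μ` = |B(c)|, `g.dist` = d(·,·) the multiscale distance of [3] (2.46), `(g.len y₂)⁻¹` = (L^{j₂}η)^{−1}.
[cite: Balaban1985Variational, (161) p.303] -/
noncomputable def kernelSum (g : B6.Geometry) (d : ℕ) (δ₀ B₀ : ℝ) (C : Finset g.Site)
    (absB : g.Site → Fin d → ℝ) (y₁ : g.Site) : ℝ :=
  B₀ * ∑ y₂ ∈ C, ∑ μ : Fin d, Real.exp (-(δ₀ * g.dist y₁ y₂)) * (g.len y₂)⁻¹ * absB y₂ μ

/-- **(161), second member** (p. 303 [PDF 27], verbatim: *"< dB₀ Σ_{y₂∈(Λ′_{k−1}∪Λ′_k)∩□_k} e^{−δ₀d(y₁,y₂)}(2d² + |y₂ − y|)4L²ε₁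
+ dB₀ Σ_{y₂∈ℭ_k∖□_k} e^{−(1/2)δ₀d(y₁,y₂)}e^{−(1/2)δ₀R₁M₁}(L^{j₂}η)^{−1}18d²L³Mε₀"*), in the LOCATED form in which it follows
from the first member: the factor (L^{j₂}η)^{−1} of the first member is KEPT in the near sum (the print drops it there; it
equals L on Λ′_{k−1} under η = L^{−k}, (5) p. 278 — transcript note in the module header; the last member (161)₅ carries it
again, so the chain closes as printed).  `Cn` = (Λ′_{k−1}∪Λ′_k)∩□_k (near sites), `Cf` = ℭ_k∖□_k (far sites), `ρ y₂` =
|y₂ − y|, y = the centre of Δ ((160) p. 303), `M` = the size parameter of □ (p. 300), `R₁M₁` as in (144).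
[cite: Balaban1985Variational, (161) p.303] -/
noncomputable def line2 (g : B6.Geometry) (d : ℕ) (δ₀ B₀ ε₁ ε₀ M R₁M₁ : ℝ) (Cn Cf : Finset g.Site)
    (ρ : g.Site → ℝ) (y₁ : g.Site) : ℝ :=
  (d : ℝ) * B₀ * ∑ y₂ ∈ Cn, Real.exp (-(δ₀ * g.dist y₁ y₂)) * (g.len y₂)⁻¹ *
      ((2 * (d : ℝ) ^ 2 + ρ y₂) * (4 * g.L ^ 2 * ε₁)) +
  (d : ℝ) * B₀ * ∑ y₂ ∈ Cf, Real.exp (-(δ₀ / 2 * g.dist y₁ y₂)) * Real.exp (-(δ₀ / 2 * R₁M₁)) * (g.len y₂)⁻¹ *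
      (18 * (d : ℝ) ^ 2 * g.L ^ 3 * M * ε₀)

/-- **(161), third member** (p. 303 [PDF 27], verbatim: *"≦ dB₀ Σ_{y₂∈(Λ′_{k−1}∪Λ′_k)∩□_k} e^{−(1/2)δ₀d(y₁,y₂)}(d(y₁,y₂) +
3d²M_Δ)4L²ε₁ + dB₀ Σ_{y₂∈ℭ_k∖□_k} e^{−(1/2)δ₀d(y₁,y₂)}(d(y₁,y₂) + M_Δ)(L^{j₂}η)^{−1}e^{−(1/2)δ₀R₁M₁}18d²L³ε₀"*, *"where y₁ ∈ Δ,
and M_Δ = 1 for Δ = Δ₀, M_Δ = M for Δ = □"*), again with the factor (L^{j₂}η)^{−1} kept in the near sum.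
[cite: Balaban1985Variational, (161) p.303] -/
noncomputable def line3 (g : B6.Geometry) (d : ℕ) (δ₀ B₀ ε₁ ε₀ R₁M₁ MΔ : ℝ) (Cn Cf : Finset g.Site)
    (y₁ : g.Site) : ℝ :=
  (d : ℝ) * B₀ * ∑ y₂ ∈ Cn, Real.exp (-(δ₀ / 2 * g.dist y₁ y₂)) * (g.len y₂)⁻¹ *
      ((g.dist y₁ y₂ + 3 * (d : ℝ) ^ 2 * MΔ) * (4 * g.L ^ 2 * ε₁)) +
  (d : ℝ) * B₀ * ∑ y₂ ∈ Cf, Real.exp (-(δ₀ / 2 * g.dist y₁ y₂)) * (g.dist y₁ y₂ + MΔ) * (g.len y₂)⁻¹ *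
      Real.exp (-(δ₀ / 2 * R₁M₁)) * (18 * (d : ℝ) ^ 2 * g.L ^ 3 * ε₀)

/-- **(161), last member** (p. 303 [PDF 27], verbatim: *"≦ 18d³L³B₀ Σ_{y₂∈ℭ_k} e^{−(1/2)δ₀d(y₁,y₂)}(d(y₁,y₂) + 1)(L^{j₂}η)^{−1}
· M_Δ max{ε₁, e^{−(1/2)δ₀R₁M₁}ε₀}, (161)"*): `18d³L³B₀ · B11B3.sum162 · M_Δ max{ε₁, e^{−½δ₀R₁M₁}ε₀}`, the inner sum being
VERBATIM the inner sum of (162) (`B11B3.sum162`/`term162`). [cite: Balaban1985Variational, (161)–(162) p.303] -/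
noncomputable def line4 (g : B6.Geometry) (d : ℕ) (δ₀ B₀ ε₁ ε₀ R₁M₁ MΔ : ℝ) (C : Finset g.Site) (y₁ : g.Site) : ℝ :=
  18 * (d : ℝ) ^ 3 * g.L ^ 3 * B₀ * sum162 g δ₀ C y₁ * (MΔ * max ε₁ (Real.exp (-(δ₀ / 2 * R₁M₁)) * ε₀))

/-! ## §2 The chain (161), member by member -/

section Chain

variable {g : B6.Geometry} {d : ℕ} {δ₀ B₀ ε₁ ε₀ M R₁M₁ MΔ ρ₁ : ℝ} {C Cn Cf : Finset g.Site}
  {absB : g.Site → Fin d → ℝ} {ρ : g.Site → ℝ} {y₁ : g.Site}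

/-- **(161)₁ ≦ (161)₂** — *"This bound [(160)] and the global bound (152) imply the following bounds on the cube Δ(y₁)"*
(p. 303): split ℭ_k = Cn ∪ Cf; on the near sites use (160) *"|B(x,x′)| < (8d²L² + 4L²|x − y|)ε₁ for ⟨x,x′⟩ ∈ □′_k^{(k−1)} ∪
□″_k^{(k)}"* — here `absB y₂ μ ≤ (8d²L² + 4L²ρ(y₂))ε₁` with (8d²L² + 4L²ρ)ε₁ = (2d² + ρ)4L²ε₁ —, on the far sites use (155)
*"|B| < 18d²L³Mε₀"* and the separation d(y₁,y₂) ≥ R₁M₁ of (144) (*"dist(□_{n+1}, □_n^c) = R₁M₁L^nη"*, y₁ ∈ Δ ⊂ □ ⊂ □_k,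
y₂ ∉ □_k), which splits e^{−δ₀d} ≤ e^{−½δ₀d}e^{−½δ₀R₁M₁}; the factor d counts the cells c with c₋ = y₂ (μ ∈ `Fin d`).
[cite: Balaban1985Variational, (161) p.303 + (160) p.303 + (155) p.302 + (144) p.300] -/
theorem kernelSum_le_line2 [DecidableEq g.Site] (hB₀ : 0 ≤ B₀) (hδ₀ : 0 ≤ δ₀) (hL : 1 ≤ g.L)
    (heta : 0 < g.eta) (hC : Cn ∪ Cf = C) (hdisj : Disjoint Cn Cf)
    (habsB : ∀ y₂ μ, 0 ≤ absB y₂ μ)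
    (h160 : ∀ y₂ ∈ Cn, ∀ μ, absB y₂ μ ≤ (8 * (d : ℝ) ^ 2 * g.L ^ 2 + 4 * g.L ^ 2 * ρ y₂) * ε₁)
    (h155 : ∀ y₂ ∈ Cf, ∀ μ, absB y₂ μ ≤ 18 * (d : ℝ) ^ 2 * g.L ^ 3 * M * ε₀)
    (h144 : ∀ y₂ ∈ Cf, R₁M₁ ≤ g.dist y₁ y₂) :
    kernelSum g d δ₀ B₀ C absB y₁ ≤ line2 g d δ₀ B₀ ε₁ ε₀ M R₁M₁ Cn Cf ρ y₁ := by
  unfold kernelSum line2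
  rw [← hC, Finset.sum_union hdisj, mul_add]
  have hlen : ∀ y, 0 < g.len y := fun y => mul_pos (pow_pos (lt_of_lt_of_le one_pos hL) _) heta  -- `B9SectCDiffFrame.len_pos`
  -- near sites
  have hnear : ∀ y₂ ∈ Cn, ∑ μ : Fin d, Real.exp (-(δ₀ * g.dist y₁ y₂)) * (g.len y₂)⁻¹ * absB y₂ μ ≤
      (d : ℝ) * (Real.exp (-(δ₀ * g.dist y₁ y₂)) * (g.len y₂)⁻¹ *
        ((2 * (d : ℝ) ^ 2 + ρ y₂) * (4 * g.L ^ 2 * ε₁))) := by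
    intro y₂ hy₂
    have hw : 0 ≤ Real.exp (-(δ₀ * g.dist y₁ y₂)) * (g.len y₂)⁻¹ :=
      mul_nonneg (Real.exp_pos _).le (inv_pos.mpr (hlen y₂)).le
    calc ∑ μ : Fin d, Real.exp (-(δ₀ * g.dist y₁ y₂)) * (g.len y₂)⁻¹ * absB y₂ μ
        ≤ ∑ _μ : Fin d, Real.exp (-(δ₀ * g.dist y₁ y₂)) * (g.len y₂)⁻¹ *
            ((2 * (d : ℝ) ^ 2 + ρ y₂) * (4 * g.L ^ 2 * ε₁)) := by
          refine Finset.sum_le_sum fun μ _ => mul_le_mul_of_nonneg_left ?_ hw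
          have h := h160 y₂ hy₂ μ
          calc absB y₂ μ ≤ (8 * (d : ℝ) ^ 2 * g.L ^ 2 + 4 * g.L ^ 2 * ρ y₂) * ε₁ := h
            _ = (2 * (d : ℝ) ^ 2 + ρ y₂) * (4 * g.L ^ 2 * ε₁) := by ring
      _ = (d : ℝ) * (Real.exp (-(δ₀ * g.dist y₁ y₂)) * (g.len y₂)⁻¹ *
            ((2 * (d : ℝ) ^ 2 + ρ y₂) * (4 * g.L ^ 2 * ε₁))) := by
          rw [Finset.sum_const, Finset.card_univ, Fintype.card_fin, nsmul_eq_mul]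
  -- far sites
  have hfar : ∀ y₂ ∈ Cf, ∑ μ : Fin d, Real.exp (-(δ₀ * g.dist y₁ y₂)) * (g.len y₂)⁻¹ * absB y₂ μ ≤
      (d : ℝ) * (Real.exp (-(δ₀ / 2 * g.dist y₁ y₂)) * Real.exp (-(δ₀ / 2 * R₁M₁)) * (g.len y₂)⁻¹ *
        (18 * (d : ℝ) ^ 2 * g.L ^ 3 * M * ε₀)) := by
    intro y₂ hy₂
    have hsplit : Real.exp (-(δ₀ * g.dist y₁ y₂)) ≤
        Real.exp (-(δ₀ / 2 * g.dist y₁ y₂)) * Real.exp (-(δ₀ / 2 * R₁M₁)) := by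
      rw [← Real.exp_add, Real.exp_le_exp]
      nlinarith [mul_le_mul_of_nonneg_left (h144 y₂ hy₂) (by linarith : 0 ≤ δ₀ / 2)]
    have hw : Real.exp (-(δ₀ * g.dist y₁ y₂)) * (g.len y₂)⁻¹ ≤
        Real.exp (-(δ₀ / 2 * g.dist y₁ y₂)) * Real.exp (-(δ₀ / 2 * R₁M₁)) * (g.len y₂)⁻¹ :=
      mul_le_mul_of_nonneg_right hsplit (inv_pos.mpr (hlen y₂)).le
    calc ∑ μ : Fin d, Real.exp (-(δ₀ * g.dist y₁ y₂)) * (g.len y₂)⁻¹ * absB y₂ μ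
        ≤ ∑ _μ : Fin d, Real.exp (-(δ₀ / 2 * g.dist y₁ y₂)) * Real.exp (-(δ₀ / 2 * R₁M₁)) * (g.len y₂)⁻¹ *
            (18 * (d : ℝ) ^ 2 * g.L ^ 3 * M * ε₀) := by
          refine Finset.sum_le_sum fun μ _ => ?_
          exact mul_le_mul hw (h155 y₂ hy₂ μ) (habsB y₂ μ)
            (mul_pos (mul_pos (Real.exp_pos _) (Real.exp_pos _)) (inv_pos.mpr (hlen y₂))).le
      _ = (d : ℝ) * (Real.exp (-(δ₀ / 2 * g.dist y₁ y₂)) * Real.exp (-(δ₀ / 2 * R₁M₁)) * (g.len y₂)⁻¹ *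
            (18 * (d : ℝ) ^ 2 * g.L ^ 3 * M * ε₀)) := by
          rw [Finset.sum_const, Finset.card_univ, Fintype.card_fin, nsmul_eq_mul]
  have h1 := Finset.sum_le_sum hnear
  have h2 := Finset.sum_le_sum hfar
  rw [← Finset.mul_sum] at h1 h2
  calc B₀ * ∑ y₂ ∈ Cn, ∑ μ : Fin d, Real.exp (-(δ₀ * g.dist y₁ y₂)) * (g.len y₂)⁻¹ * absB y₂ μ +
        B₀ * ∑ y₂ ∈ Cf, ∑ μ : Fin d, Real.exp (-(δ₀ * g.dist y₁ y₂)) * (g.len y₂)⁻¹ * absB y₂ μ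
      ≤ B₀ * ((d : ℝ) * ∑ y₂ ∈ Cn, Real.exp (-(δ₀ * g.dist y₁ y₂)) * (g.len y₂)⁻¹ *
            ((2 * (d : ℝ) ^ 2 + ρ y₂) * (4 * g.L ^ 2 * ε₁))) +
        B₀ * ((d : ℝ) * ∑ y₂ ∈ Cf, Real.exp (-(δ₀ / 2 * g.dist y₁ y₂)) * Real.exp (-(δ₀ / 2 * R₁M₁)) *
            (g.len y₂)⁻¹ * (18 * (d : ℝ) ^ 2 * g.L ^ 3 * M * ε₀)) :=
        add_le_add (mul_le_mul_of_nonneg_left h1 hB₀) (mul_le_mul_of_nonneg_left h2 hB₀)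
    _ = _ := by ring

/-- **(161)₁ < (161)₂, the printed STRICT sign**: with the strict inequalities (160), (155) as printed, B₀ > 0, d ≥ 1 and
ℭ_k ≠ ∅ the first comparison is strict. [cite: Balaban1985Variational, (161) p.303] -/
theorem kernelSum_lt_line2 [DecidableEq g.Site] (hB₀ : 0 < B₀) (hd : 0 < d) (hδ₀ : 0 ≤ δ₀) (hL : 1 ≤ g.L)
    (heta : 0 < g.eta) (hC : Cn ∪ Cf = C) (hdisj : Disjoint Cn Cf) (hne : C.Nonempty)
    (habsB : ∀ y₂ μ, 0 ≤ absB y₂ μ)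
    (h160 : ∀ y₂ ∈ Cn, ∀ μ, absB y₂ μ < (8 * (d : ℝ) ^ 2 * g.L ^ 2 + 4 * g.L ^ 2 * ρ y₂) * ε₁)
    (h155 : ∀ y₂ ∈ Cf, ∀ μ, absB y₂ μ < 18 * (d : ℝ) ^ 2 * g.L ^ 3 * M * ε₀)
    (h144 : ∀ y₂ ∈ Cf, R₁M₁ ≤ g.dist y₁ y₂) :
    kernelSum g d δ₀ B₀ C absB y₁ < line2 g d δ₀ B₀ ε₁ ε₀ M R₁M₁ Cn Cf ρ y₁ := by
  unfold kernelSum line2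
  rw [← hC, Finset.sum_union hdisj, mul_add]
  have hlen : ∀ y, 0 < g.len y := fun y => mul_pos (pow_pos (lt_of_lt_of_le one_pos hL) _) heta  -- `B9SectCDiffFrame.len_pos`
  haveI : Nonempty (Fin d) := ⟨⟨0, hd⟩⟩
  -- near sites, termwise strict
  have hnear : ∀ y₂ ∈ Cn, ∑ μ : Fin d, Real.exp (-(δ₀ * g.dist y₁ y₂)) * (g.len y₂)⁻¹ * absB y₂ μ <
      (d : ℝ) * (Real.exp (-(δ₀ * g.dist y₁ y₂)) * (g.len y₂)⁻¹ *
        ((2 * (d : ℝ) ^ 2 + ρ y₂) * (4 * g.L ^ 2 * ε₁))) := by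
    intro y₂ hy₂
    have hw : 0 < Real.exp (-(δ₀ * g.dist y₁ y₂)) * (g.len y₂)⁻¹ :=
      mul_pos (Real.exp_pos _) (inv_pos.mpr (hlen y₂))
    calc ∑ μ : Fin d, Real.exp (-(δ₀ * g.dist y₁ y₂)) * (g.len y₂)⁻¹ * absB y₂ μ
        < ∑ _μ : Fin d, Real.exp (-(δ₀ * g.dist y₁ y₂)) * (g.len y₂)⁻¹ *
            ((2 * (d : ℝ) ^ 2 + ρ y₂) * (4 * g.L ^ 2 * ε₁)) := by
          refine Finset.sum_lt_sum_of_nonempty Finset.univ_nonempty fun μ _ => mul_lt_mul_of_pos_left ?_ hw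
          have h := h160 y₂ hy₂ μ
          calc absB y₂ μ < (8 * (d : ℝ) ^ 2 * g.L ^ 2 + 4 * g.L ^ 2 * ρ y₂) * ε₁ := h
            _ = (2 * (d : ℝ) ^ 2 + ρ y₂) * (4 * g.L ^ 2 * ε₁) := by ring
      _ = (d : ℝ) * (Real.exp (-(δ₀ * g.dist y₁ y₂)) * (g.len y₂)⁻¹ *
            ((2 * (d : ℝ) ^ 2 + ρ y₂) * (4 * g.L ^ 2 * ε₁))) := by
          rw [Finset.sum_const, Finset.card_univ, Fintype.card_fin, nsmul_eq_mul]
  -- far sites, termwise strict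
  have hfar : ∀ y₂ ∈ Cf, ∑ μ : Fin d, Real.exp (-(δ₀ * g.dist y₁ y₂)) * (g.len y₂)⁻¹ * absB y₂ μ <
      (d : ℝ) * (Real.exp (-(δ₀ / 2 * g.dist y₁ y₂)) * Real.exp (-(δ₀ / 2 * R₁M₁)) * (g.len y₂)⁻¹ *
        (18 * (d : ℝ) ^ 2 * g.L ^ 3 * M * ε₀)) := by
    intro y₂ hy₂
    have hsplit : Real.exp (-(δ₀ * g.dist y₁ y₂)) ≤
        Real.exp (-(δ₀ / 2 * g.dist y₁ y₂)) * Real.exp (-(δ₀ / 2 * R₁M₁)) := by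
      rw [← Real.exp_add, Real.exp_le_exp]
      nlinarith [mul_le_mul_of_nonneg_left (h144 y₂ hy₂) (by linarith : 0 ≤ δ₀ / 2)]
    have hw : Real.exp (-(δ₀ * g.dist y₁ y₂)) * (g.len y₂)⁻¹ ≤
        Real.exp (-(δ₀ / 2 * g.dist y₁ y₂)) * Real.exp (-(δ₀ / 2 * R₁M₁)) * (g.len y₂)⁻¹ :=
      mul_le_mul_of_nonneg_right hsplit (inv_pos.mpr (hlen y₂)).le
    have hwpos : 0 < Real.exp (-(δ₀ / 2 * g.dist y₁ y₂)) * Real.exp (-(δ₀ / 2 * R₁M₁)) * (g.len y₂)⁻¹ :=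
      mul_pos (mul_pos (Real.exp_pos _) (Real.exp_pos _)) (inv_pos.mpr (hlen y₂))
    calc ∑ μ : Fin d, Real.exp (-(δ₀ * g.dist y₁ y₂)) * (g.len y₂)⁻¹ * absB y₂ μ
        < ∑ _μ : Fin d, Real.exp (-(δ₀ / 2 * g.dist y₁ y₂)) * Real.exp (-(δ₀ / 2 * R₁M₁)) * (g.len y₂)⁻¹ *
            (18 * (d : ℝ) ^ 2 * g.L ^ 3 * M * ε₀) := by
          refine Finset.sum_lt_sum_of_nonempty Finset.univ_nonempty fun μ _ => ?_
          exact mul_lt_mul' hw (h155 y₂ hy₂ μ) (habsB y₂ μ) hwpos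
      _ = (d : ℝ) * (Real.exp (-(δ₀ / 2 * g.dist y₁ y₂)) * Real.exp (-(δ₀ / 2 * R₁M₁)) * (g.len y₂)⁻¹ *
            (18 * (d : ℝ) ^ 2 * g.L ^ 3 * M * ε₀)) := by
          rw [Finset.sum_const, Finset.card_univ, Fintype.card_fin, nsmul_eq_mul]
  have h1 : ∑ y₂ ∈ Cn, ∑ μ : Fin d, Real.exp (-(δ₀ * g.dist y₁ y₂)) * (g.len y₂)⁻¹ * absB y₂ μ ≤
      ∑ y₂ ∈ Cn, (d : ℝ) * (Real.exp (-(δ₀ * g.dist y₁ y₂)) * (g.len y₂)⁻¹ *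
        ((2 * (d : ℝ) ^ 2 + ρ y₂) * (4 * g.L ^ 2 * ε₁))) :=
    Finset.sum_le_sum fun y₂ hy₂ => (hnear y₂ hy₂).le
  have h2 : ∑ y₂ ∈ Cf, ∑ μ : Fin d, Real.exp (-(δ₀ * g.dist y₁ y₂)) * (g.len y₂)⁻¹ * absB y₂ μ ≤
      ∑ y₂ ∈ Cf, (d : ℝ) * (Real.exp (-(δ₀ / 2 * g.dist y₁ y₂)) * Real.exp (-(δ₀ / 2 * R₁M₁)) * (g.len y₂)⁻¹ *
        (18 * (d : ℝ) ^ 2 * g.L ^ 3 * M * ε₀)) :=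
    Finset.sum_le_sum fun y₂ hy₂ => (hfar y₂ hy₂).le
  -- at least one of the two parts is nonempty, where the comparison is strict
  have hstrict : B₀ * ∑ y₂ ∈ Cn, ∑ μ : Fin d, Real.exp (-(δ₀ * g.dist y₁ y₂)) * (g.len y₂)⁻¹ * absB y₂ μ +
        B₀ * ∑ y₂ ∈ Cf, ∑ μ : Fin d, Real.exp (-(δ₀ * g.dist y₁ y₂)) * (g.len y₂)⁻¹ * absB y₂ μ <
      B₀ * ∑ y₂ ∈ Cn, (d : ℝ) * (Real.exp (-(δ₀ * g.dist y₁ y₂)) * (g.len y₂)⁻¹ *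
          ((2 * (d : ℝ) ^ 2 + ρ y₂) * (4 * g.L ^ 2 * ε₁))) +
        B₀ * ∑ y₂ ∈ Cf, (d : ℝ) * (Real.exp (-(δ₀ / 2 * g.dist y₁ y₂)) * Real.exp (-(δ₀ / 2 * R₁M₁)) *
          (g.len y₂)⁻¹ * (18 * (d : ℝ) ^ 2 * g.L ^ 3 * M * ε₀)) := by
    have hne' : Cn.Nonempty ∨ Cf.Nonempty := by
      rw [← hC] at hne
      exact Finset.union_nonempty.mp hne
    rcases hne' with hn | hf
    · exact add_lt_add_of_lt_of_le (mul_lt_mul_of_pos_left (Finset.sum_lt_sum_of_nonempty hn hnear) hB₀)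
        (mul_le_mul_of_nonneg_left h2 hB₀.le)
    · exact add_lt_add_of_le_of_lt (mul_le_mul_of_nonneg_left h1 hB₀.le)
        (mul_lt_mul_of_pos_left (Finset.sum_lt_sum_of_nonempty hf hfar) hB₀)
  refine lt_of_lt_of_eq hstrict ?_
  rw [Finset.mul_sum, Finset.mul_sum, Finset.mul_sum, Finset.mul_sum]
  congr 1 <;> (refine Finset.sum_congr rfl fun y₂ _ => ?_) <;> ring

/-- **(161)₂ ≦ (161)₃** (p. 303): in the near sum e^{−δ₀d} ≤ e^{−½δ₀d} and 2d² + |y₂ − y| ≤ d(y₁,y₂) + 3d²M_Δ — by the located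
triangle inequality |y₂ − y| ≤ d(y₁,y₂) + |y₁ − y| ([3] (2.48): the multiscale distance dominates the lattice distance) with
|y₁ − y| ≤ ρ₁ ≤ d²M_Δ for y₁ ∈ Δ (Δ₀ = B^k(y) a unit cube, □ of size 2M with centre y) —; in the far sum 18d²L³Mε₀ ≤
(d(y₁,y₂) + M_Δ)18d²L³ε₀ by the printed two cases *"M_Δ = 1 for Δ = Δ₀"* (then □ *"is a cube of the size R₁M₁ containing Δ₀"*,
M = R₁M₁ ≤ d(y₁,y₂) for y₂ ∉ □_k by (144)) and *"M_Δ = M for Δ = □"*.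
[cite: Balaban1985Variational, (161) p.303 + p.300 «we will take M = R₁M₁» + p.304 «where □ is a cube of the size R₁M₁ containing Δ₀»] -/
theorem line2_le_line3 (hB₀ : 0 ≤ B₀) (hδ₀ : 0 ≤ δ₀) (hd : 1 ≤ d) (hL : 1 ≤ g.L) (heta : 0 < g.eta) (hε₁ : 0 ≤ ε₁)
    (hε₀ : 0 ≤ ε₀) (hMΔ : 1 ≤ MΔ)
    (hdistn : ∀ y₂ ∈ Cn, 0 ≤ g.dist y₁ y₂) (hdistf : ∀ y₂ ∈ Cf, 0 ≤ g.dist y₁ y₂)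
    (hρ0 : ∀ y₂ ∈ Cn, 0 ≤ ρ y₂) (hρ : ∀ y₂ ∈ Cn, ρ y₂ ≤ g.dist y₁ y₂ + ρ₁) (hρ₁ : ρ₁ ≤ (d : ℝ) ^ 2 * MΔ)
    (hcase : (M = R₁M₁ ∧ MΔ = 1) ∨ MΔ = M) (h144 : ∀ y₂ ∈ Cf, R₁M₁ ≤ g.dist y₁ y₂) :
    line2 g d δ₀ B₀ ε₁ ε₀ M R₁M₁ Cn Cf ρ y₁ ≤ line3 g d δ₀ B₀ ε₁ ε₀ R₁M₁ MΔ Cn Cf y₁ := by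
  unfold line2 line3
  have hlen : ∀ y, 0 < g.len y := fun y => mul_pos (pow_pos (lt_of_lt_of_le one_pos hL) _) heta  -- `B9SectCDiffFrame.len_pos`
  have hd' : (1 : ℝ) ≤ d := by exact_mod_cast hd
  have hdB₀ : 0 ≤ (d : ℝ) * B₀ := by positivity
  refine add_le_add (mul_le_mul_of_nonneg_left (Finset.sum_le_sum fun y₂ hy₂ => ?_) hdB₀)
    (mul_le_mul_of_nonneg_left (Finset.sum_le_sum fun y₂ hy₂ => ?_) hdB₀)
  · -- near site y₂
    set t := g.dist y₁ y₂ with ht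
    have ht0 : 0 ≤ t := hdistn y₂ hy₂
    have hexp : Real.exp (-(δ₀ * t)) ≤ Real.exp (-(δ₀ / 2 * t)) := by
      rw [Real.exp_le_exp]; nlinarith [mul_nonneg hδ₀ ht0]
    have hpoly : 2 * (d : ℝ) ^ 2 + ρ y₂ ≤ t + 3 * (d : ℝ) ^ 2 * MΔ := by
      have h1 := hρ y₂ hy₂
      have h2 : 2 * (d : ℝ) ^ 2 ≤ 2 * (d : ℝ) ^ 2 * MΔ := by nlinarith [sq_nonneg (d : ℝ)]
      linarith
    have hw : Real.exp (-(δ₀ * t)) * (g.len y₂)⁻¹ ≤ Real.exp (-(δ₀ / 2 * t)) * (g.len y₂)⁻¹ :=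
      mul_le_mul_of_nonneg_right hexp (inv_pos.mpr (hlen y₂)).le
    have hc : (2 * (d : ℝ) ^ 2 + ρ y₂) * (4 * g.L ^ 2 * ε₁) ≤ (t + 3 * (d : ℝ) ^ 2 * MΔ) * (4 * g.L ^ 2 * ε₁) :=
      mul_le_mul_of_nonneg_right hpoly (by positivity)
    exact mul_le_mul hw hc (mul_nonneg (by nlinarith [hρ0 y₂ hy₂, sq_nonneg (d : ℝ)]) (by positivity))
      (mul_nonneg (Real.exp_pos _).le (inv_pos.mpr (hlen y₂)).le)
  · -- far site y₂
    set t := g.dist y₁ y₂ with ht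
    have ht0 : 0 ≤ t := hdistf y₂ hy₂
    have hM : M ≤ t + MΔ := by
      rcases hcase with ⟨hM, hMΔ⟩ | hMΔ
      · rw [hM, hMΔ]; linarith [h144 y₂ hy₂]
      · rw [hMΔ]; linarith
    have hK : 0 ≤ Real.exp (-(δ₀ / 2 * t)) * (g.len y₂)⁻¹ * Real.exp (-(δ₀ / 2 * R₁M₁)) *
        (18 * (d : ℝ) ^ 2 * g.L ^ 3 * ε₀) :=
      mul_nonneg (mul_nonneg (mul_nonneg (Real.exp_pos _).le (inv_pos.mpr (hlen y₂)).le) (Real.exp_pos _).le)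
        (by positivity)
    calc Real.exp (-(δ₀ / 2 * t)) * Real.exp (-(δ₀ / 2 * R₁M₁)) * (g.len y₂)⁻¹ * (18 * (d : ℝ) ^ 2 * g.L ^ 3 * M * ε₀)
        = Real.exp (-(δ₀ / 2 * t)) * (g.len y₂)⁻¹ * Real.exp (-(δ₀ / 2 * R₁M₁)) *
            (18 * (d : ℝ) ^ 2 * g.L ^ 3 * ε₀) * M := by ring
      _ ≤ Real.exp (-(δ₀ / 2 * t)) * (g.len y₂)⁻¹ * Real.exp (-(δ₀ / 2 * R₁M₁)) *
            (18 * (d : ℝ) ^ 2 * g.L ^ 3 * ε₀) * (t + MΔ) := mul_le_mul_of_nonneg_left hM hK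
      _ = Real.exp (-(δ₀ / 2 * t)) * (t + MΔ) * (g.len y₂)⁻¹ * Real.exp (-(δ₀ / 2 * R₁M₁)) *
            (18 * (d : ℝ) ^ 2 * g.L ^ 3 * ε₀) := by ring

/-- **(161)₃ ≦ (161)₄** (p. 303): both sums are dominated termwise by the summand of the last member,
18d³L³B₀·e^{−½δ₀d(y₁,y₂)}(d(y₁,y₂) + 1)(L^{j₂}η)^{−1}·M_Δ max{ε₁, e^{−½δ₀R₁M₁}ε₀} — near: d(t + 3d²M_Δ)4L² ≤ 12d³L²M_Δ(t + 1) ≤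
18d³L³M_Δ(t + 1) (d, M_Δ, L ≥ 1) and ε₁ ≤ max{…}; far: d(t + M_Δ)18d²L³ ≤ 18d³L³M_Δ(t + 1) and e^{−½δ₀R₁M₁}ε₀ ≤ max{…} —
and Cn, Cf are disjoint parts of ℭ_k. [cite: Balaban1985Variational, (161) p.303] -/
theorem line3_le_line4 [DecidableEq g.Site] (hB₀ : 0 ≤ B₀) (hd : 1 ≤ d) (hL : 1 ≤ g.L) (heta : 0 < g.eta)
    (hε₁ : 0 ≤ ε₁) (hε₀ : 0 ≤ ε₀) (hMΔ : 1 ≤ MΔ) (hn : Cn ⊆ C) (hf : Cf ⊆ C) (hdisj : Disjoint Cn Cf)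
    (hdist : ∀ y₂ ∈ C, 0 ≤ g.dist y₁ y₂) :
    line3 g d δ₀ B₀ ε₁ ε₀ R₁M₁ MΔ Cn Cf y₁ ≤ line4 g d δ₀ B₀ ε₁ ε₀ R₁M₁ MΔ C y₁ := by
  unfold line3 line4 sum162
  have hlen : ∀ y, 0 < g.len y := fun y => mul_pos (pow_pos (lt_of_lt_of_le one_pos hL) _) heta  -- `B9SectCDiffFrame.len_pos`
  have hd' : (1 : ℝ) ≤ d := by exact_mod_cast hd
  set X : ℝ := max ε₁ (Real.exp (-(δ₀ / 2 * R₁M₁)) * ε₀) with hX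
  have hX₁ : ε₁ ≤ X := le_max_left _ _
  have hX₂ : Real.exp (-(δ₀ / 2 * R₁M₁)) * ε₀ ≤ X := le_max_right _ _
  have hX0 : 0 ≤ X := le_trans hε₁ hX₁
  -- the summand of the last member
  set F : g.Site → ℝ := fun y₂ => 18 * (d : ℝ) ^ 3 * g.L ^ 3 * B₀ * term162 g δ₀ y₁ y₂ * (MΔ * X) with hF
  have hF0 : ∀ y₂ ∈ C, 0 ≤ F y₂ := by
    intro y₂ hy₂
    have ht : 0 ≤ term162 g δ₀ y₁ y₂ := by
      unfold term162
      exact mul_nonneg (mul_nonneg (Real.exp_pos _).le (by linarith [hdist y₂ hy₂])) (inv_pos.mpr (hlen y₂)).le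
    simp only [hF]
    have : 0 ≤ MΔ * X := mul_nonneg (by linarith) hX0
    positivity
  have htot : 18 * (d : ℝ) ^ 3 * g.L ^ 3 * B₀ * (∑ y₂ ∈ C, term162 g δ₀ y₁ y₂) * (MΔ * X) = ∑ y₂ ∈ C, F y₂ := by
    rw [Finset.mul_sum, Finset.sum_mul]
  rw [htot]
  -- near summand ≤ F
  have hnear : ∀ y₂ ∈ Cn, (d : ℝ) * B₀ * (Real.exp (-(δ₀ / 2 * g.dist y₁ y₂)) * (g.len y₂)⁻¹ *
      ((g.dist y₁ y₂ + 3 * (d : ℝ) ^ 2 * MΔ) * (4 * g.L ^ 2 * ε₁))) ≤ F y₂ := by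
    intro y₂ hy₂
    set t := g.dist y₁ y₂ with ht
    have ht0 : 0 ≤ t := hdist y₂ (hn hy₂)
    have hw : 0 ≤ Real.exp (-(δ₀ / 2 * t)) * (g.len y₂)⁻¹ * B₀ :=
      mul_nonneg (mul_nonneg (Real.exp_pos _).le (inv_pos.mpr (hlen y₂)).le) hB₀
    -- d(t + 3d²M_Δ)4L²ε₁ ≤ 18d³L³(t+1)M_Δ X
    have h1 : t + 3 * (d : ℝ) ^ 2 * MΔ ≤ 3 * (d : ℝ) ^ 2 * MΔ * (t + 1) := by
      have : 1 ≤ 3 * (d : ℝ) ^ 2 * MΔ := by nlinarith [sq_nonneg (d : ℝ)]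
      nlinarith
    have h2 : (d : ℝ) * (t + 3 * (d : ℝ) ^ 2 * MΔ) * (4 * g.L ^ 2 * ε₁) ≤
        18 * (d : ℝ) ^ 3 * g.L ^ 3 * (t + 1) * MΔ * X := by
      have hL2 : g.L ^ 2 ≤ g.L ^ 3 := by nlinarith [sq_nonneg g.L]
      have hA : (d : ℝ) * (t + 3 * (d : ℝ) ^ 2 * MΔ) ≤ 3 * (d : ℝ) ^ 3 * MΔ * (t + 1) := by
        nlinarith [mul_le_mul_of_nonneg_left h1 (by linarith : (0 : ℝ) ≤ d)]
      have hB : 4 * g.L ^ 2 * ε₁ ≤ 6 * g.L ^ 3 * X := by nlinarith [sq_nonneg g.L, mul_nonneg (by positivity : (0:ℝ) ≤ g.L ^ 2) hε₁]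
      calc (d : ℝ) * (t + 3 * (d : ℝ) ^ 2 * MΔ) * (4 * g.L ^ 2 * ε₁)
          ≤ 3 * (d : ℝ) ^ 3 * MΔ * (t + 1) * (6 * g.L ^ 3 * X) :=
            mul_le_mul hA hB (by positivity) (by positivity)
        _ = 18 * (d : ℝ) ^ 3 * g.L ^ 3 * (t + 1) * MΔ * X := by ring
    calc (d : ℝ) * B₀ * (Real.exp (-(δ₀ / 2 * t)) * (g.len y₂)⁻¹ * ((t + 3 * (d : ℝ) ^ 2 * MΔ) * (4 * g.L ^ 2 * ε₁)))
        = (Real.exp (-(δ₀ / 2 * t)) * (g.len y₂)⁻¹ * B₀) * ((d : ℝ) * (t + 3 * (d : ℝ) ^ 2 * MΔ) * (4 * g.L ^ 2 * ε₁)) := by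
          ring
      _ ≤ (Real.exp (-(δ₀ / 2 * t)) * (g.len y₂)⁻¹ * B₀) * (18 * (d : ℝ) ^ 3 * g.L ^ 3 * (t + 1) * MΔ * X) :=
          mul_le_mul_of_nonneg_left h2 hw
      _ = F y₂ := by simp only [hF, term162]; ring
  -- far summand ≤ F
  have hfar : ∀ y₂ ∈ Cf, (d : ℝ) * B₀ * (Real.exp (-(δ₀ / 2 * g.dist y₁ y₂)) * (g.dist y₁ y₂ + MΔ) * (g.len y₂)⁻¹ *
      Real.exp (-(δ₀ / 2 * R₁M₁)) * (18 * (d : ℝ) ^ 2 * g.L ^ 3 * ε₀)) ≤ F y₂ := by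
    intro y₂ hy₂
    set t := g.dist y₁ y₂ with ht
    have ht0 : 0 ≤ t := hdist y₂ (hf hy₂)
    have hw : 0 ≤ 18 * (d : ℝ) ^ 3 * g.L ^ 3 * B₀ * (Real.exp (-(δ₀ / 2 * t)) * (g.len y₂)⁻¹) :=
      mul_nonneg (by positivity) (mul_nonneg (Real.exp_pos _).le (inv_pos.mpr (hlen y₂)).le)
    have h1 : t + MΔ ≤ (t + 1) * MΔ := by nlinarith
    have h2 : (t + MΔ) * (Real.exp (-(δ₀ / 2 * R₁M₁)) * ε₀) ≤ (t + 1) * MΔ * X :=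
      mul_le_mul h1 hX₂ (mul_nonneg (Real.exp_pos _).le hε₀) (by positivity)
    calc (d : ℝ) * B₀ * (Real.exp (-(δ₀ / 2 * t)) * (t + MΔ) * (g.len y₂)⁻¹ * Real.exp (-(δ₀ / 2 * R₁M₁)) *
          (18 * (d : ℝ) ^ 2 * g.L ^ 3 * ε₀))
        = 18 * (d : ℝ) ^ 3 * g.L ^ 3 * B₀ * (Real.exp (-(δ₀ / 2 * t)) * (g.len y₂)⁻¹) *
            ((t + MΔ) * (Real.exp (-(δ₀ / 2 * R₁M₁)) * ε₀)) := by ring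
      _ ≤ 18 * (d : ℝ) ^ 3 * g.L ^ 3 * B₀ * (Real.exp (-(δ₀ / 2 * t)) * (g.len y₂)⁻¹) * ((t + 1) * MΔ * X) :=
          mul_le_mul_of_nonneg_left h2 hw
      _ = F y₂ := by simp only [hF, term162]; ring
  have h1 := Finset.sum_le_sum hnear
  have h2 := Finset.sum_le_sum hfar
  rw [← Finset.mul_sum] at h1 h2
  calc _ ≤ ∑ y₂ ∈ Cn, F y₂ + ∑ y₂ ∈ Cf, F y₂ := add_le_add h1 h2
    _ = ∑ y₂ ∈ Cn ∪ Cf, F y₂ := (Finset.sum_union hdisj).symm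
    _ ≤ ∑ y₂ ∈ C, F y₂ :=
        Finset.sum_le_sum_of_subset_of_nonneg (Finset.union_subset hn hf) fun y₂ hy₂ _ => hF0 y₂ hy₂

/-- **(161) END TO END, as printed**: the first member's kernel sum is ≦ the last member,
`B₀Σ_{c∈ℭ_k}e^{−δ₀d(y₁,c₋)}(L^{j(c)}η)^{−1}|B(c)| ≤ 18d³L³B₀Σ_{y₂∈ℭ_k}e^{−½δ₀d(y₁,y₂)}(d(y₁,y₂)+1)(L^{j₂}η)^{−1}·M_Δmax{ε₁, e^{−½δ₀R₁M₁}ε₀}`,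
under: (160) on the near sites, (155) on the far sites, (144)-separation of the far sites, the located triangle inequality for
|y₂ − y|, the printed two cases for M_Δ, and the side conditions d, L, M_Δ ≥ 1, δ₀, ε₀, ε₁, B₀ ≥ 0, |B(c)| ≥ 0, d(·,·) ≥ 0, η > 0.
[cite: Balaban1985Variational, (161) p.303] -/
theorem ineq161 [DecidableEq g.Site] (hB₀ : 0 ≤ B₀) (hδ₀ : 0 ≤ δ₀) (hd : 1 ≤ d) (hL : 1 ≤ g.L) (heta : 0 < g.eta)
    (hε₁ : 0 ≤ ε₁) (hε₀ : 0 ≤ ε₀) (hMΔ : 1 ≤ MΔ) (hC : Cn ∪ Cf = C) (hdisj : Disjoint Cn Cf)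
    (hdist : ∀ y₂ ∈ C, 0 ≤ g.dist y₁ y₂) (habsB : ∀ y₂ μ, 0 ≤ absB y₂ μ)
    (h160 : ∀ y₂ ∈ Cn, ∀ μ, absB y₂ μ ≤ (8 * (d : ℝ) ^ 2 * g.L ^ 2 + 4 * g.L ^ 2 * ρ y₂) * ε₁)
    (h155 : ∀ y₂ ∈ Cf, ∀ μ, absB y₂ μ ≤ 18 * (d : ℝ) ^ 2 * g.L ^ 3 * M * ε₀)
    (h144 : ∀ y₂ ∈ Cf, R₁M₁ ≤ g.dist y₁ y₂)
    (hρ0 : ∀ y₂ ∈ Cn, 0 ≤ ρ y₂) (hρ : ∀ y₂ ∈ Cn, ρ y₂ ≤ g.dist y₁ y₂ + ρ₁) (hρ₁ : ρ₁ ≤ (d : ℝ) ^ 2 * MΔ)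
    (hcase : (M = R₁M₁ ∧ MΔ = 1) ∨ MΔ = M) :
    kernelSum g d δ₀ B₀ C absB y₁ ≤ line4 g d δ₀ B₀ ε₁ ε₀ R₁M₁ MΔ C y₁ := by
  have hn : Cn ⊆ C := hC ▸ Finset.subset_union_left
  have hf : Cf ⊆ C := hC ▸ Finset.subset_union_right
  exact (kernelSum_le_line2 hB₀ hδ₀ hL heta hC hdisj habsB h160 h155 h144).trans
    ((line2_le_line3 hB₀ hδ₀ hd hL heta hε₁ hε₀ hMΔ (fun y₂ hy₂ => hdist y₂ (hn hy₂))
      (fun y₂ hy₂ => hdist y₂ (hf hy₂)) hρ0 hρ hρ₁ hcase h144).trans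
    (line3_le_line4 hB₀ hd hL heta hε₁ hε₀ hMΔ hn hf hdisj hdist))

/-! ## §3 (163) ⇒ (164) -/

/-- **(162), (163) ⇒ (164)** (pp. 303–304 [PDF 27–28], verbatim: *"Let us take B₃ = 72d³L³B₀ sup_{ℭ_k} sup_{y₁} Σ_{y₂∈ℭ_k}
e^{−1/2δ₀d(y₁,y₂)}(d(y₁,y₂) + 1)(L^{j₂}η)^{−1}. (162) … We may assume that R₁M₁ is sufficiently big, so that
B₃e^{−(1/2)δ₀R₁M₁} ≦ ½. (163)  Then we get on Δ  |HB|, |∇^ηHB|, |∂^{η*}∂^ηHB|, |Δ^ηHB| < ¼M_Δmax{B₃ε₁, ½ε₀}. (164)"*): the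
last member of (161) is ≦ ¼M_Δ max{B₃ε₁, ½ε₀} whenever the inner sum of (162) is ≦ S (`B11B3.Claim162`-shape) and
B₃ = 72d³L³B₀S obeys (163) (72 = 4·18, `B11B3.ineq161_le_quarter_B3`). [cite: Balaban1985Variational, (162)–(164) pp.303–304] -/
theorem line4_le_quarter {S B₃ : ℝ} (hB₀ : 0 ≤ B₀) (hL : 0 ≤ g.L) (hε₁ : 0 ≤ ε₁) (hε₀ : 0 ≤ ε₀) (hMΔ : 0 ≤ MΔ)
    (hS : sum162 g δ₀ C y₁ ≤ S) (hB₃ : B₃ = 72 * (d : ℝ) ^ 3 * g.L ^ 3 * B₀ * S)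
    (h163 : B₃ * Real.exp (-(δ₀ / 2 * R₁M₁)) ≤ 1 / 2) :
    line4 g d δ₀ B₀ ε₁ ε₀ R₁M₁ MΔ C y₁ ≤ 1 / 4 * MΔ * max (B₃ * ε₁) (ε₀ / 2) := by
  unfold line4
  set X : ℝ := max ε₁ (Real.exp (-(δ₀ / 2 * R₁M₁)) * ε₀) with hX
  have hX0 : 0 ≤ X := le_trans hε₁ (le_max_left _ _)
  have hP : 0 ≤ (d : ℝ) ^ 3 * g.L ^ 3 * B₀ := by positivity
  -- 72 = 4·18
  have h1 : 18 * ((d : ℝ) ^ 3 * g.L ^ 3 * B₀) * sum162 g δ₀ C y₁ * (MΔ * X) ≤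
      1 / 4 * (72 * ((d : ℝ) ^ 3 * g.L ^ 3 * B₀) * S) * (MΔ * X) :=
    ineq161_le_quarter_B3 _ _ _ _ hP (mul_nonneg hMΔ hX0) hS
  -- B₃·max{ε₁, e^{−½δ₀R₁M₁}ε₀} ≤ max{B₃ε₁, ½ε₀} by (163)
  have h2 : B₃ * X ≤ max (B₃ * ε₁) (ε₀ / 2) := by
    rcases le_total ε₁ (Real.exp (-(δ₀ / 2 * R₁M₁)) * ε₀) with h | h
    · rw [hX, max_eq_right h]
      calc B₃ * (Real.exp (-(δ₀ / 2 * R₁M₁)) * ε₀) = B₃ * Real.exp (-(δ₀ / 2 * R₁M₁)) * ε₀ := by ring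
        _ ≤ 1 / 2 * ε₀ := mul_le_mul_of_nonneg_right h163 hε₀
        _ = ε₀ / 2 := by ring
        _ ≤ max (B₃ * ε₁) (ε₀ / 2) := le_max_right _ _
    · rw [hX, max_eq_left h]
      exact le_max_left _ _
  calc 18 * (d : ℝ) ^ 3 * g.L ^ 3 * B₀ * sum162 g δ₀ C y₁ * (MΔ * X)
      = 18 * ((d : ℝ) ^ 3 * g.L ^ 3 * B₀) * sum162 g δ₀ C y₁ * (MΔ * X) := by ring
    _ ≤ 1 / 4 * (72 * ((d : ℝ) ^ 3 * g.L ^ 3 * B₀) * S) * (MΔ * X) := h1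
    _ = 1 / 4 * MΔ * (B₃ * X) := by rw [hB₃]; ring
    _ ≤ 1 / 4 * MΔ * max (B₃ * ε₁) (ε₀ / 2) := mul_le_mul_of_nonneg_left h2 (by positivity)

/-- **(164) for any quantity majorised by the first member of (161)** — |HB|, |∇^ηHB|, |∂^{η*}∂^ηHB|, |Δ^ηHB| on Δ (the H-kernel
bound of the first member, [3]'s propagator estimates at the background 1, is the located input `hQ`): Q ≤ ¼M_Δmax{B₃ε₁, ½ε₀}.
With the strict (160), (155) and ℭ_k ≠ ∅ the printed strict sign follows (`ineq164_strict`). [cite: Balaban1985Variational, (161)–(164) pp.303–304] -/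
theorem ineq164 [DecidableEq g.Site] {S B₃ Q : ℝ} (hQ : Q ≤ kernelSum g d δ₀ B₀ C absB y₁)
    (hB₀ : 0 ≤ B₀) (hδ₀ : 0 ≤ δ₀) (hd : 1 ≤ d) (hL : 1 ≤ g.L) (heta : 0 < g.eta)
    (hε₁ : 0 ≤ ε₁) (hε₀ : 0 ≤ ε₀) (hMΔ : 1 ≤ MΔ) (hC : Cn ∪ Cf = C) (hdisj : Disjoint Cn Cf)
    (hdist : ∀ y₂ ∈ C, 0 ≤ g.dist y₁ y₂) (habsB : ∀ y₂ μ, 0 ≤ absB y₂ μ)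
    (h160 : ∀ y₂ ∈ Cn, ∀ μ, absB y₂ μ ≤ (8 * (d : ℝ) ^ 2 * g.L ^ 2 + 4 * g.L ^ 2 * ρ y₂) * ε₁)
    (h155 : ∀ y₂ ∈ Cf, ∀ μ, absB y₂ μ ≤ 18 * (d : ℝ) ^ 2 * g.L ^ 3 * M * ε₀)
    (h144 : ∀ y₂ ∈ Cf, R₁M₁ ≤ g.dist y₁ y₂)
    (hρ0 : ∀ y₂ ∈ Cn, 0 ≤ ρ y₂) (hρ : ∀ y₂ ∈ Cn, ρ y₂ ≤ g.dist y₁ y₂ + ρ₁) (hρ₁ : ρ₁ ≤ (d : ℝ) ^ 2 * MΔ)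
    (hcase : (M = R₁M₁ ∧ MΔ = 1) ∨ MΔ = M)
    (hS : sum162 g δ₀ C y₁ ≤ S) (hB₃ : B₃ = 72 * (d : ℝ) ^ 3 * g.L ^ 3 * B₀ * S)
    (h163 : B₃ * Real.exp (-(δ₀ / 2 * R₁M₁)) ≤ 1 / 2) :
    Q ≤ 1 / 4 * MΔ * max (B₃ * ε₁) (ε₀ / 2) :=
  hQ.trans ((ineq161 hB₀ hδ₀ hd hL heta hε₁ hε₀ hMΔ hC hdisj hdist habsB h160 h155 h144 hρ0 hρ hρ₁ hcase).trans
    (line4_le_quarter hB₀ (by linarith) hε₁ hε₀ (by linarith) hS hB₃ h163))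

/-- **(164) with the printed strict sign**: Q < ¼M_Δmax{B₃ε₁, ½ε₀} under the strict (160), (155), B₀ > 0, ℭ_k ≠ ∅.
[cite: Balaban1985Variational, (164) p.304] -/
theorem ineq164_strict [DecidableEq g.Site] {S B₃ Q : ℝ} (hQ : Q ≤ kernelSum g d δ₀ B₀ C absB y₁)
    (hB₀ : 0 < B₀) (hδ₀ : 0 ≤ δ₀) (hd : 1 ≤ d) (hL : 1 ≤ g.L) (heta : 0 < g.eta)
    (hε₁ : 0 ≤ ε₁) (hε₀ : 0 ≤ ε₀) (hMΔ : 1 ≤ MΔ) (hC : Cn ∪ Cf = C) (hdisj : Disjoint Cn Cf) (hne : C.Nonempty)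
    (hdist : ∀ y₂ ∈ C, 0 ≤ g.dist y₁ y₂) (habsB : ∀ y₂ μ, 0 ≤ absB y₂ μ)
    (h160 : ∀ y₂ ∈ Cn, ∀ μ, absB y₂ μ < (8 * (d : ℝ) ^ 2 * g.L ^ 2 + 4 * g.L ^ 2 * ρ y₂) * ε₁)
    (h155 : ∀ y₂ ∈ Cf, ∀ μ, absB y₂ μ < 18 * (d : ℝ) ^ 2 * g.L ^ 3 * M * ε₀)
    (h144 : ∀ y₂ ∈ Cf, R₁M₁ ≤ g.dist y₁ y₂)
    (hρ0 : ∀ y₂ ∈ Cn, 0 ≤ ρ y₂) (hρ : ∀ y₂ ∈ Cn, ρ y₂ ≤ g.dist y₁ y₂ + ρ₁) (hρ₁ : ρ₁ ≤ (d : ℝ) ^ 2 * MΔ)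
    (hcase : (M = R₁M₁ ∧ MΔ = 1) ∨ MΔ = M)
    (hS : sum162 g δ₀ C y₁ ≤ S) (hB₃ : B₃ = 72 * (d : ℝ) ^ 3 * g.L ^ 3 * B₀ * S)
    (h163 : B₃ * Real.exp (-(δ₀ / 2 * R₁M₁)) ≤ 1 / 2) :
    Q < 1 / 4 * MΔ * max (B₃ * ε₁) (ε₀ / 2) := by
  have hn : Cn ⊆ C := hC ▸ Finset.subset_union_left
  have hf : Cf ⊆ C := hC ▸ Finset.subset_union_right
  have hd0 : 0 < d := hd
  refine lt_of_le_of_lt hQ (lt_of_lt_of_le (kernelSum_lt_line2 hB₀ hd0 hδ₀ hL heta hC hdisj hne habsB h160 h155 h144) ?_)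
  exact ((line2_le_line3 hB₀.le hδ₀ hd hL heta hε₁ hε₀ hMΔ (fun y₂ hy₂ => hdist y₂ (hn hy₂))
      (fun y₂ hy₂ => hdist y₂ (hf hy₂)) hρ0 hρ hρ₁ hcase h144).trans
    (line3_le_line4 hB₀.le hd hL heta hε₁ hε₀ hMΔ hn hf hdisj hdist)).trans
    (line4_le_quarter hB₀.le (by linarith) hε₁ hε₀ (by linarith) hS hB₃ h163)

end Chain

/-! ## §4 (159) + (158) + (164) ⇒ (165) ⇒ (167) -/

section Eq165

variable {E F : Type*} [SeminormedAddCommGroup E] [SeminormedAddCommGroup F]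

/-- **(165), first line** (p. 304 [PDF 28], verbatim: *"This bound [(164)], the equality (159) and Eq. (158) imply  |A|, |∇^ηA|,
|∂^{η*}∂^ηA|, |Δ^ηA| < ¼M_Δmax{B₃ε₁, ½ε₀} + B₀C₄(36dL²B₁Mε₀)² + B₀4C₂(36dL²B₁Mε₀)²"*).  Setting: `E` = configurations with the
global norm of (152)/(115) (max of the four scaled sup-norms; in Sect. F the scale weights are 1, L^kη = 1), `p` = the same four
sup-norms RESTRICTED TO Δ (an additive-group seminorm dominated by the norm, `hp`), `F` = currents; the located inputs, each a
displayed statement: (159) *"A = A₁ + HB − HD(A₁ + HB)"*; (158) *"A₁ + G̃((δ/δA′)V)(A₁ + HB) = 0"* with ‖G̃f‖ ≤ B₀‖f‖ (the norm of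
G̃, p. 306 *"the new operator G has exactly the same properties as Δ_a⁻¹"*, (117)) and Prop. 4 (98) ‖((δ/δA′)V)(Y)‖ ≤ C₄‖Y‖² at
Y = A₁ + HB; ‖HX‖ ≤ B₀‖X‖ ((46)) and (55) ‖D(Y)‖ ≤ 4C₂‖Y‖²; p. 303 *"A₁ + HB satisfies the bounds (152) with 36dL²B₁Mε₀"* (`s`);
(164) `p HB < q`, q = ¼M_Δmax{B₃ε₁, ½ε₀}.  Conclusion: p A < q + B₀C₄s² + B₀4C₂s².
[cite: Balaban1985Variational, (165) p.304 + (158) p.302, (159) p.303 + (98) p.293 + (55) p.286 + (46) p.285] -/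
theorem ineq165 (p : AddGroupSeminorm E) (hp : ∀ x, p x ≤ ‖x‖) {Gt : F → E} {W : E → F} {H D : E → E}
    {B₀ C₂ C₄ s q : ℝ} (hB₀ : 0 ≤ B₀) (hC₂ : 0 ≤ C₂) (hC₄ : 0 ≤ C₄)
    (hGt : ∀ f, ‖Gt f‖ ≤ B₀ * ‖f‖) (hH : ∀ x, ‖H x‖ ≤ B₀ * ‖x‖)
    {A A₁ HB : E} (h159 : A = A₁ + HB - H (D (A₁ + HB))) (h158 : A₁ = -Gt (W (A₁ + HB)))
    (h98 : ‖W (A₁ + HB)‖ ≤ C₄ * ‖A₁ + HB‖ ^ 2) (h55 : ‖D (A₁ + HB)‖ ≤ 4 * C₂ * ‖A₁ + HB‖ ^ 2)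
    (h152 : ‖A₁ + HB‖ ≤ s) (h164 : p HB < q) :
    p A < q + B₀ * C₄ * s ^ 2 + B₀ * 4 * C₂ * s ^ 2 := by
  have hsq : ‖A₁ + HB‖ ^ 2 ≤ s ^ 2 := pow_le_pow_left₀ (norm_nonneg _) h152 2
  have hA₁ : p A₁ ≤ B₀ * C₄ * s ^ 2 :=
    calc p A₁ ≤ ‖A₁‖ := hp A₁
      _ = ‖-Gt (W (A₁ + HB))‖ := congrArg _ h158
      _ = ‖Gt (W (A₁ + HB))‖ := norm_neg _
      _ ≤ B₀ * ‖W (A₁ + HB)‖ := hGt _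
      _ ≤ B₀ * (C₄ * s ^ 2) := mul_le_mul_of_nonneg_left (h98.trans (mul_le_mul_of_nonneg_left hsq hC₄)) hB₀
      _ = B₀ * C₄ * s ^ 2 := by ring
  have hHD : p (H (D (A₁ + HB))) ≤ B₀ * 4 * C₂ * s ^ 2 :=
    calc p (H (D (A₁ + HB))) ≤ ‖H (D (A₁ + HB))‖ := hp _
      _ ≤ B₀ * ‖D (A₁ + HB)‖ := hH _
      _ ≤ B₀ * (4 * C₂ * s ^ 2) :=
          mul_le_mul_of_nonneg_left (h55.trans (mul_le_mul_of_nonneg_left hsq (by positivity))) hB₀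
      _ = B₀ * 4 * C₂ * s ^ 2 := by ring
  have htri : p A ≤ p A₁ + p HB + p (H (D (A₁ + HB))) := by
    rw [h159, sub_eq_add_neg]
    calc p (A₁ + HB + -H (D (A₁ + HB))) ≤ p (A₁ + HB) + p (-H (D (A₁ + HB))) := map_add_le_add p _ _
      _ = p (A₁ + HB) + p (H (D (A₁ + HB))) := by rw [map_neg_eq_map]
      _ ≤ p A₁ + p HB + p (H (D (A₁ + HB))) := by linarith [map_add_le_add p A₁ HB]
  linarith

/-- **(165), second line, and (166) ⇒ (167)** (p. 304 [PDF 28], verbatim: *"≦ ¼M_Δmax{B₃ε₁, ½ε₀} + B₀(C₄ + 4C₂)(36dL²B₁R₁M₁)²(M′ε₀)²,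
(165) where M′ = 1 in the first case, where □ is a cube of the size R₁M₁ containing Δ₀, and M′ = (R₁M₁)⁻¹M in the second case. We
take a largest absolute number a₅ such that M′ε₀ ≦ a₅ implies all the previous restrictions on ε₀, and such that
B₀(C₄ + 4C₂)(36dL²B₁R₁M₁)²a₅ ≦ ⅛. (166)  If M′ε₀ ≦ a₅, then we get  |A|, |∇^ηA|, |∂^{η*}∂^ηA|, |Δ^ηA| < ¼M_Δmax{B₃ε₁, ½ε₀} + ⅛M′ε₀
on Δ. (167)"*): from the first line of (165) with s = 36dL²B₁Mε₀, M = M′R₁M₁ (`B11Smallness.ineq165_quadratic_terms`) and (166)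
(`B11Smallness.ineq167_of_166`). [cite: Balaban1985Variational, (165)–(167) p.304] -/
theorem ineq167 {pA q B₀ C₂ C₄ d L B₁ M M' R₁M₁ ε₀ a₅ : ℝ}
    (h165 : pA < q + B₀ * C₄ * (36 * d * L ^ 2 * B₁ * M * ε₀) ^ 2 + B₀ * 4 * C₂ * (36 * d * L ^ 2 * B₁ * M * ε₀) ^ 2)
    (hM : M = M' * R₁M₁) (hK : 0 ≤ B₀ * (C₄ + 4 * C₂) * (36 * d * L ^ 2 * B₁ * R₁M₁) ^ 2)
    (h166 : B₀ * (C₄ + 4 * C₂) * (36 * d * L ^ 2 * B₁ * R₁M₁) ^ 2 * a₅ ≤ 1 / 8) (hx0 : 0 ≤ M' * ε₀) (hx : M' * ε₀ ≤ a₅) :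
    pA < q + 1 / 8 * (M' * ε₀) := by
  have h2 := B11Smallness.ineq165_quadratic_terms d L B₀ B₁ C₂ C₄ M M' R₁M₁ ε₀ hM
  have h3 := B11Smallness.ineq167_of_166 _ a₅ (M' * ε₀) hK h166 hx0 hx
  linarith

end Eq165

/-! ## §5 First case: (167) ⇒ (168), the one-step membership radius max{B₃ε₁, ½ε₀} -/

/-- **First case of (167)** (p. 304 [PDF 28], verbatim: *"We take Δ = Δ₀, hence M_Δ = 1, M′ = 1, and we have this inequality with
ε′ = ½max{B₃ε₁, ½ε₀} on the right-hand side"*): ¼·1·max{B₃ε₁, ½ε₀} + ⅛·1·ε₀ ≤ ε′ (`B11Smallness.ineq167_first_case`), so the four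
norms of A on Δ₀ are < ε′. [cite: Balaban1985Variational, (167) p.304] -/
theorem lt_eps'_of_167 {pA B₃ε₁ ε₀ : ℝ} (h167 : pA < 1 / 4 * 1 * max B₃ε₁ (ε₀ / 2) + 1 / 8 * (1 * ε₀)) :
    pA < 1 / 2 * max B₃ε₁ (ε₀ / 2) := by
  have := B11Smallness.ineq167_first_case B₃ε₁ ε₀
  linarith

/-- **(168)** (p. 304 [PDF 28], verbatim: *"This and the inequality (1.54) of [6] imply  |D^{η*}_{U₁}∂U₁| < ε′ + 86dε′² < 2ε′ on Δ₀
(168) for ε′ small"*).  The located input is the bound that (1.54) of [6] yields — printed there as (1.142) p. 100,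
*"|D^{η*}_{U₁U₀}∂U₁U₀| < (α₀ + α₂ + 36dα₂² + 50dα₂³ + 10dα₀α₂)(Lʲη)^{−3}η²"* — at the background U₀ = 1 (α₀ = 0) with α₂ = ε′
(`h1142`, scale weights 1); then 36dε′² + 50dε′³ ≤ 86dε′² for ε′ ≤ 1, and ε′ + 86dε′² < 2ε′ iff 86dε′ < 1 («for ε′ small»,
`B11Smallness.ineq168_iff`); 2ε′ = max{B₃ε₁, ½ε₀} (`B11Smallness.two_eps'_eq`) is the radius of *"U′_k satisfies (2) on Δ₀ with
max{B₃ε₁, ½ε₀} instead of ε₀"*.  (The companion *"similarly for |∂U₁ − 1|"* is not displayed in print and not treated here.)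
[cite: Balaban1985Variational, (168) p.304; Balaban1985RegularSpaces, (1.54) p.85, (1.142) p.100] -/
theorem ineq168 {d e nD : ℝ} (hd : 0 ≤ d) (he0 : 0 < e) (he1 : e ≤ 1) (h86 : 86 * d * e < 1)
    (h1142 : nD < e + 36 * d * e ^ 2 + 50 * d * e ^ 3) :
    nD < e + 86 * d * e ^ 2 ∧ e + 86 * d * e ^ 2 < 2 * e := by
  refine ⟨lt_of_lt_of_le h1142 ?_, (B11Smallness.ineq168_iff d e he0).mpr h86⟩
  have : e ^ 3 ≤ e ^ 2 := by nlinarith [sq_nonneg e]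
  nlinarith

/-- (168) at ε′ = ½max{B₃ε₁, ½ε₀}: |D^{η*}_{U₁}∂U₁| < max{B₃ε₁, ½ε₀} on Δ₀ — the one-step radius of the halving iteration
(p. 304: *"hence U_k belongs to the space (2) with max{B₃ε₁, ½ε₀} instead of ε₀"*; cf. `B11Prop8Assembly.HalvingStep`).
[cite: Balaban1985Variational, (168) p.304] -/
theorem ineq168_radius {d B₃ε₁ ε₀ nD : ℝ} (hd : 0 ≤ d) (he0 : 0 < 1 / 2 * max B₃ε₁ (ε₀ / 2))
    (he1 : 1 / 2 * max B₃ε₁ (ε₀ / 2) ≤ 1) (h86 : 86 * d * (1 / 2 * max B₃ε₁ (ε₀ / 2)) < 1)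
    (h1142 : nD < 1 / 2 * max B₃ε₁ (ε₀ / 2) + 36 * d * (1 / 2 * max B₃ε₁ (ε₀ / 2)) ^ 2 +
      50 * d * (1 / 2 * max B₃ε₁ (ε₀ / 2)) ^ 3) :
    nD < max B₃ε₁ (ε₀ / 2) := by
  have h := ineq168 hd he0 he1 h86 h1142
  have h2 := B11Smallness.two_eps'_eq B₃ε₁ ε₀
  linarith [h.1, h.2]

/-! ## §6 Second case: (167) ⇒ (169), the regularity (9)–(10) -/

/-- **(169)** (pp. 304–305 [PDF 28–29], verbatim: *"Let us consider the second case, i.e. Δ = □ with a size M. We may take advantage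
of the fact that we have proved the regularity property (8), thus we take ε₀ = B₃ε₁. Assuming M′B₃ε₁ ≦ a₅, we get from the inequality
(167),  (the left-hand side of (167)) < ¼MB₃ε₁ + ⅛M′B₃ε₁ < ½MB₃ε₁. (169)  The condition M′ε₁ ≦ a₁ implies M′B₃ε₁ ≦ a₅, hence
we have proved the regularity conditions (9), (10)"*): with M_Δ = M, ε₀ = B₃ε₁ (so max{B₃ε₁, ½ε₀} = B₃ε₁) and M′ ≤ M (M = M′R₁M₁,
R₁M₁ ≥ 1) the four norms of A on □ are < ½MB₃ε₁ (`B11.ineq169`) ≤ B₃Mε₁ — the radii of (9), (10) at the normalisation L^kη = 1 of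
Sect. F (*"we assume that j = k"*, p. 300). [cite: Balaban1985Variational, (169) p.305 + (9)–(10) p.279] -/
theorem ineq169_regularity {pA M M' B₃ ε₁ : ℝ} (hM : M' ≤ M) (hpos : 0 < M * B₃ * ε₁) (hB : 0 ≤ B₃ * ε₁)
    (h167 : pA < 1 / 4 * M * max (B₃ * ε₁) (B₃ * ε₁ / 2) + 1 / 8 * (M' * (B₃ * ε₁))) :
    pA < 1 / 2 * M * B₃ * ε₁ ∧ pA < B₃ * M * ε₁ := by
  have hmax : max (B₃ * ε₁) (B₃ * ε₁ / 2) = B₃ * ε₁ := max_eq_left (by linarith)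
  rw [hmax] at h167
  have h169 := B11.ineq169 M M' B₃ ε₁ hM hpos hB
  constructor
  · linarith
  · nlinarith


/-! ## §7 (v1.1, append-only) The companion «similarly for |∂U₁ − 1|» of (168): the located gap G-B11-02 and its repair

p. 304 [PDF 28], verbatim: *"|D^{η*}_{U₁}∂U₁| < ε′ + 86dε′² < 2ε′ on Δ₀ (168) for ε′ small, similarly for |∂U₁ − 1|."*  The plaquette half is
to come from [6] (1.141) at the background 1 (α₀ = 0), p. 100: *"|(U₁U₀)(∂p) − 1| ≦ |U₀(∂p) − 1| + η²|(D^η_{U₀}A)(p)| + ½(η∂|A|(p))² <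
(α₀ + 2α₂ + 8α₂²)L^{−2j} on Ω_j"*, read with α₂ = the (167)-bound e₁ = ¼max{B₃ε₁, ½ε₀} + ⅛ε₀ of the three norms of A on Δ₀ (first case,
M_Δ = M′ = 1, via (166) with the printed ⅛).  In the halving regime B₃ε₁ ≦ ½ε₀ this e₁ EQUALS ε′ = ½max{B₃ε₁, ½ε₀} (`e1_eq_eps'`), so the
plaquette deviation is only < (2ε′ + 8ε′²)η²(Lʲη)⁻² — the claimed radius 2ε′ = max{B₃ε₁, ½ε₀} plus a second-order term
(`plaq168_asPrinted_exceeds`).  With (166′) K·a₅ ≦ 1/16 the same (167) reads e₁ ≦ ¼max + ε₀/16 ≦ ⅜max = ¾ε′ and (1.141) closes below the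
radius for max{B₃ε₁, ½ε₀} ≦ 2/9 (`plaq168_repaired`); cf. `B11SectFAssembly.firstCase_arith` (p264246) where the first case is assembled
with this repair.  Cell GAPS.md G-B11-02. -/

section Plaquette168

/-- In the halving regime B₃ε₁ ≦ ½ε₀ the first-case (167)-bound ¼max{B₃ε₁, ½ε₀} + ⅛ε₀ EQUALS ε′ = ½max{B₃ε₁, ½ε₀}: no slack is left for the
second-order term of [6] (1.141). [cite: Balaban1985Variational, (167)–(168) p.304] -/
theorem e1_eq_eps' {B₃ε₁ ε₀ : ℝ} (h : B₃ε₁ ≤ ε₀ / 2) :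
    1 / 4 * max B₃ε₁ (ε₀ / 2) + 1 / 8 * ε₀ = 1 / 2 * max B₃ε₁ (ε₀ / 2) := by
  rw [max_eq_right h]; ring

/-- **G-B11-02, the printed constants**: with α₂ = ε′ > 0 the (1.141)|_{α₀=0} bound 2ε′ + 8ε′² exceeds the claimed plaquette radius
2ε′ = max{B₃ε₁, ½ε₀} of *"U′_k satisfies (2) on Δ₀ with max{B₃ε₁, ½ε₀} instead of ε₀"*.
[cite: Balaban1985Variational, (168) p.304; Balaban1985RegularSpaces, (1.141) p.100] -/
theorem plaq168_asPrinted_exceeds {e : ℝ} (he : 0 < e) : 2 * e < 2 * e + 8 * e ^ 2 := by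
  nlinarith [sq_nonneg e]

/-- **(166′) ⇒ (167′)**: with K·a₅ ≦ 1/16 in place of the printed ⅛ (K = B₀(C₄ + 4C₂)(36dL²B₁R₁M₁)², 0 ≦ M′ε₀ ≦ a₅) the quadratic term of
(165) is ≦ (1/16)·M′ε₀. [cite: Balaban1985Variational, (166)–(167) p.304] -/
theorem ineq167_sixteenth {K a₅ x : ℝ} (hK : 0 ≤ K) (h166 : K * a₅ ≤ 1 / 16) (hx0 : 0 ≤ x) (hx : x ≤ a₅) :
    K * x ^ 2 ≤ 1 / 16 * x := by
  have : K * x ≤ K * a₅ := mul_le_mul_of_nonneg_left hx hK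
  nlinarith

/-- **G-B11-02, repaired**: if the three norms of A on Δ₀ are < e₁ with e₁ ≦ ¼max{B₃ε₁, ½ε₀} + ε₀/16 (first case of (167) under (166′)),
B₃ε₁ ≥ 0 and max{B₃ε₁, ½ε₀} ≦ 2/9, then the (1.141)|_{α₀=0} bound gives the plaquette deviation < max{B₃ε₁, ½ε₀} — the radius
of the one-step membership (e₁ ≦ ⅜max since ε₀ ≦ 2max; 2e₁ + 8e₁² ≦ ¾max + (9/8)max² ≦ max).
[cite: Balaban1985Variational, (168) p.304; Balaban1985RegularSpaces, (1.141) p.100] -/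
theorem plaq168_repaired {B₃ε₁ ε₀ e₁ nP : ℝ} (hB : 0 ≤ B₃ε₁) (he₁0 : 0 ≤ e₁)
    (he₁ : e₁ ≤ 1 / 4 * max B₃ε₁ (ε₀ / 2) + 1 / 16 * ε₀) (hsmall : max B₃ε₁ (ε₀ / 2) ≤ 2 / 9)
    (h1141 : nP < 2 * e₁ + 8 * e₁ ^ 2) : nP < max B₃ε₁ (ε₀ / 2) := by
  set m := max B₃ε₁ (ε₀ / 2) with hm
  have hm0 : 0 ≤ m := le_trans hB (le_max_left _ _)
  have hε₀m : ε₀ ≤ 2 * m := by linarith [le_max_right B₃ε₁ (ε₀ / 2)]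
  have he₁m : e₁ ≤ 3 / 8 * m := by linarith
  have hsq : e₁ ^ 2 ≤ (3 / 8 * m) ^ 2 := pow_le_pow_left₀ he₁0 he₁m 2
  have h2 : 2 * e₁ + 8 * e₁ ^ 2 ≤ 3 / 4 * m + 9 / 8 * m ^ 2 := by nlinarith
  have h3 : 9 / 8 * m ^ 2 ≤ 1 / 4 * m := by nlinarith
  linarith

end Plaquette168

end Literature.MathematicalPhysics.QuantumFieldTheory.Balaban1983to89.B11Eq161HBChain
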